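import Literature.AnabelianGeometry.AbsoluteAnabelian.AbsTopII.TwoTripodNodalSlopeSections
import Literature.AnabelianGeometry.AbsoluteAnabelian.AbsTopII.Prop13xLabelScope
import HarnessLib

/-!
# [AbsTopII] Prop 1.3 (x) at the two-vertex nodal datum, III: `Prop_1_3_x''` HOLDS for the log points of the model

S. Mochizuki, *Topics in Absolute Anabelian Geometry II* [AbsTopII] (bib `MochizukiAbsTopII2013`; locators =
PDF pages of the kurims manuscript `paper:url-585b8d0ad0d9`), §1 Prop 1.3 (x) p. 12:

> "(x) […] Let us call `τ_I` non-verticial (respectively, non-edge-like) if `τ_I(I)` is not contained in `I_v`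
> (respectively, `I_e`) for any vertex `v` (respectively, edge `e`) of `𝔾`.  Then if `τ_I` is non-verticial and
> non-edge-like, then the image of `τ_S` is the unique cusp `e_τ` of `X` such that [for an appropriate choice of
> conjugate of `D_{e_τ}`] `τ_I(I) ⊆ D_{e_τ}`.  Now suppose that the image of `τ_S` is not a cusp.  Then `τ_I`
> satisfies the condition `τ_I(I) = I_{v_τ}` for some vertex `v_τ` of `𝔾` [and an appropriate choice of conjugate of
> `I_{v_τ}`] if and only if the image of `τ_S` is a non-nodal point of the irreducible component of `X`
> corresponding to `v_τ`; `τ_I` is non-verticial and satisfies the condition `τ_I(I) ⊆ I_{e_τ}` for some node `e_τ`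
> of `𝔾` [and an appropriate choice of conjugate of `I_{e_τ}`] if and only if the image of `τ_S` is the node of `X`
> corresponding to `e_τ`."

PROOF-ONLY companion (abc-iut-f-066 gen 7, row «P13x″-TWO-VERTEX») of `AbsTopII/TwoTripodNodalLogPoints.lean` (the
family `M.logPoints` of log points of the degenerating 4-pointed sphere `M.dpsc`: two tripods `v_A`, `v_B`, one
non-loop node, regular smoothing, cusps `c₁, c₂ | c₃, c₀`; every `Σ`) over the engine `TwoTripodNodalSlopeSections.lean`.  FACT-LIST rows F-0301 (`Prop_1_3_x`) and
F-3904 (`Prop_1_3_x'`) are «admissible at named instances only»; here they are DECIDED at this named instance: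

* `not_prop_1_3_x_dpsc`, `not_prop_1_3_x'_dpsc` — the v1/v2 predicates (free point-kind label; finding F-L4t6g6-1,
  certificates `Prop13xLabelScope.lean`) are FALSE at `M.dpsc` (two vertices, `I_v` a closed section);
* ★ `prop_1_3_x''_dpsc` — **the statement of record `DPSCIndexData.Prop_1_3_x''` HOLDS at `M.dpsc` for the family
  `M.logPoints`, every `Σ`, NO hypothesis.**  Content beyond the loop datum (`DehnTwistLoopLogPoints.lean`, one
  cusp): the UNIQUENESS of the cusp among FOUR cusps on TWO components — no `P`-conjugate of a slope-`n` section
  (`n ≥ 1`) of the cusp `c_j` lies in a `Π_𝔾`-conjugate of `D_{c'}` (`c' ≠ c_j`), of `D_e = I_e`, of `Π_{c'}`, nor in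
  any conjugate of an `I_v` (`cusp_clause_logPoints_cusp`, `isNonVerticial_logPoints_cusp`,
  `isNonEdgeLike_logPoints_cusp`, `not_le_conj_IvNode_logPoints_cusp`) — the engine `not_conj_cuspSection_le_conj`
  of part II (abc-iut-f-066 gen 6's edge-pair calculus + `c_j^n ≠ 1` in the pro-`Σ` completion); smooth members:
  `δ I_v δ⁻¹` is a `Π_𝔾`-conjugate of `I_v` and of no `I_w`, `w ≠ v` (`T ∩ gUg⁻¹ = 1`, gen 5);
* `exists_twoVertex_nodal_model_x''` — census form (every vertex and every cusp realised; cusp members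
  non-verticial and non-edge-like; no member labelled by the node, whose clause holds with both sides refuted).
HONEST FRAMING: classical profinite group theory at a constructed model (constructed ≠ geometric); an instance at a
constructed datum is consistency evidence for the typed row, not the printed theorem for stable log curves; nothing
here bears on [IUTchIII] Cor 3.12; no side taken.
-/

noncomputable section

open scoped Pointwise

namespace Literature.AnabelianGeometry.AbsoluteAnabelian.AbsTopII.TwoTripodNodal.Model

open Literature.AnabelianGeometry.SemiGraphs
open Literature.AnabelianGeometry.SemiGraphs.SemiGraphOfAnabelioids (IsProSigmaCompletion)
open Literature.AnabelianGeometry.SemiGraphs.SemiGraphOfAnabelioids.IsProSigmaCompletion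
open Literature.AnabelianGeometry.Anabelioids (IsSigmaInteger)
open Literature.GroupTheory.CombinatorialGroupTheory
open Literature.GroupTheory.CombinatorialGroupTheory.PuncturedSurfaceGroup
open _root_.Topology

variable {Sigma : Set ℕ} (M : Model Sigma)

/-! ### The free-label predicates (x), (x′) FAIL at the datum -/

/-- `I_v` is closed at the datum. [cite: MochizukiAbsTopII2013, Prop 1.3 (iii) p.11] -/
theorem isClosed_Iv (hne : Sigma.Nonempty) (hprime : ∀ p ∈ Sigma, p.Prime) (v : (M.dpsc hne hprime).Vert) :
    IsClosed (((M.dpsc hne hprime).Iv v : Set (M.dpsc hne hprime).PiH)) := by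
  rw [Iv_eq_vertSec]; exact M.isClosed_vertSec _

/-- **F-3904 `Prop_1_3_x'` (free point-kind label, `Π_𝔾`-scope) is FALSE at the two-vertex nodal datum**: the datum
has two vertices and `I_{v_A}` is a closed section (typed Prop 1.3 (iii), abc-iut-f-066 gen 5), so abc-iut-L4-t6's
certificate `not_prop_1_3_x'_of_prop13iii` applies. [cite: MochizukiAbsTopII2013, Prop 1.3 (x) p.12] -/
theorem not_prop_1_3_x'_dpsc (hne : Sigma.Nonempty) (hprime : ∀ p ∈ Sigma, p.Prime) : ¬ (M.dpsc hne hprime).Prop_1_3_x' :=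
  (M.dpsc hne hprime).not_prop_1_3_x'_of_prop13iii (M.prop13iii_dpsc hne hprime) (M.vert_zero_ne_one hne hprime)
    (M.isClosed_Iv hne hprime _)

/-- **F-0301 `Prop_1_3_x` (free point-kind label, `Π_H`-scope) is FALSE at the two-vertex nodal datum.**
[cite: MochizukiAbsTopII2013, Prop 1.3 (x) p.12] -/
theorem not_prop_1_3_x_dpsc (hne : Sigma.Nonempty) (hprime : ∀ p ∈ Sigma, p.Prime) : ¬ (M.dpsc hne hprime).Prop_1_3_x :=
  (M.dpsc hne hprime).not_prop_1_3_x_of_prop13iii (M.prop13iii_dpsc hne hprime) (M.vert_zero_ne_one hne hprime)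
    (M.isClosed_Iv hne hprime _)

section Cusp


/-- **The cusp member is NON-VERTICIAL**: `δ S_{j,n} δ⁻¹ ⊄ g I_v g⁻¹` for every `g ∈ P` and both vertices
(`I_v ⊆ D_e`, then the engine with `D = D_e`). [cite: MochizukiAbsTopII2013, Prop 1.3 (x) p.12] -/
theorem isNonVerticial_logPoints_cusp (hne : Sigma.Nonempty) (hprime : ∀ p ∈ Sigma, p.Prime) (j : Fin 4) {n : ℕ} (hn : 0 < n) (δ : M.P) : (M.logPoints hne hprime (LogPt.cusp j n hn δ)).IsNonVerticial := by
  intro v g h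
  rw [logPoints_cusp_image, Iv_eq_vertSec] at h
  obtain ⟨γ, hγ, hle⟩ := M.exists_conj_le_conj_nodeD (M.vertSec_le_nodeD v.down) g
  exact M.not_conj_cuspSection_le_conj_nodeD hne hprime j hn δ hγ (le_trans h hle)

/-- **The cusp member is NON-EDGE-LIKE**: `δ S_{j,n} δ⁻¹ ⊄ g I_ε g⁻¹` for every edge `ε` (`I_e = Π_e·T` for the node;
`I_{c'} = Π_{c'} ⊆ Π_𝔾` for a cusp, and no section lies in `Π_𝔾`). [cite: MochizukiAbsTopII2013, Prop 1.3 (x) p.12] -/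
theorem isNonEdgeLike_logPoints_cusp (hne : Sigma.Nonempty) (hprime : ∀ p ∈ Sigma, p.Prime) (j : Fin 4) {n : ℕ} (hn : 0 < n) (δ : M.P) : (M.logPoints hne hprime (LogPt.cusp j n hn δ)).IsNonEdgeLike := by
  intro ε g h
  rcases ε with e | c'
  · -- the node: `I_e = Π_e·T`
    simp only [DPSCIndexData.IEdge] at h
    rw [logPoints_cusp_image, IvNode_eq_J] at h
    obtain ⟨γ, hγ, hle⟩ := M.exists_conj_le_conj_nodeD le_rfl g
    exact M.not_conj_cuspSection_le_conj_nodeD hne hprime j hn δ hγ (le_trans h hle)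
  · -- a cusp: `I_{c'} = Π_{c'} ⊆ Π_𝔾`
    simp only [DPSCIndexData.IEdge, DPSCData.IvCusp] at h
    haveI := (M.dpsc hne hprime).normal_PiG
    have hG' : (M.logPoints hne hprime (LogPt.cusp j n hn δ)).image ≤ (M.dpsc hne hprime).PiG :=
      h.trans ((Subgroup.pointwise_smul_le_pointwise_smul_iff.mpr ((M.dpsc hne hprime).cuspSub_le c')).trans
        (Subgroup.Normal.conj_smul_eq_self g (M.dpsc hne hprime).PiG).le)
    rw [dpsc_PiG, logPoints_cusp_image] at hG'
    have hG : MulAut.conj δ • M.cuspSection j n ≤ M.PiG := hG'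
    have hbot : MulAut.conj δ • M.cuspSection j n = ⊥ := by
      rw [← inf_eq_left.mpr hG]; exact M.conj_smul_inf_PiG_eq_bot (M.cuspSection_inf_PiG hne hprime j n) δ
    have htop : M.PiG = ⊤ := by
      have h2 := M.conj_smul_sup_PiG_eq_top (M.cuspSection_sup_PiG j n) δ
      rwa [hbot, bot_sup_eq] at h2
    exact M.PiG_ne_top hne hprime htop

/-- **Clause 1 for the cusp member, proved outright**: its label IS a cusp, `c_j`, and `c_j` is the UNIQUE cusp `c'`
with `δ S_{j,n} δ⁻¹ ⊆ γ D_{c'} γ⁻¹` for some `γ ∈ Π_𝔾` (existence: `δ = γ s`, `s ∈ I_v ⊆ D_{c_j}`; uniqueness: the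
engine with `D = D_{c'}`). [cite: MochizukiAbsTopII2013, Prop 1.3 (x) p.12] -/
theorem cusp_clause_logPoints_cusp (hne : Sigma.Nonempty) (hprime : ∀ p ∈ Sigma, p.Prime) (j : Fin 4) {n : ℕ} (hn : 0 < n) (δ : M.P) :
    ∃ e : (M.dpsc hne hprime).Cusp, (M.logPoints hne hprime (LogPt.cusp j n hn δ)).kind = DPSCIndexData.PointKind.cusp e ∧
      ∀ e' : (M.dpsc hne hprime).Cusp,
        (∃ γ : (M.dpsc hne hprime).PiH, γ ∈ (M.dpsc hne hprime).PiG ∧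
          (M.logPoints hne hprime (LogPt.cusp j n hn δ)).image ≤ MulAut.conj γ • (M.dpsc hne hprime).DvCusp e') ↔
        e' = e := by
  refine ⟨⟨j⟩, rfl, fun e' => ⟨?_, ?_⟩⟩
  · rintro ⟨γ, hγ, hle⟩
    obtain ⟨j'⟩ := e'
    rw [dpsc_PiG] at hγ
    rw [logPoints_cusp_image, DvCusp_eq_sup_baseSec] at hle
    by_contra he'
    have hjj' : j' ≠ j := fun h => he' (congrArg ULift.up h)
    exact M.not_conj_cuspSection_le_conj_cuspD hne hprime j hn δ hjj' hγ hle
  · rintro rfl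
    obtain ⟨γ, hγ, s, hs, rfl⟩ := M.exists_eq_mul_of_sup_eq_top (M.baseSec_sup_PiG j) δ
    refine ⟨γ, by rw [dpsc_PiG]; exact hγ, ?_⟩
    rw [logPoints_cusp_image, DvCusp_eq_sup_baseSec]
    show MulAut.conj (γ * s) • M.cuspSection j n ≤ MulAut.conj γ • ((M.cuspGp j).map M.PiG.subtype ⊔ M.baseSec j)
    rw [map_mul, mul_smul, Subgroup.pointwise_smul_le_pointwise_smul_iff]
    calc MulAut.conj s • M.cuspSection j n ≤ MulAut.conj s • ((M.cuspGp j).map M.PiG.subtype ⊔ M.baseSec j) :=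
          Subgroup.pointwise_smul_le_pointwise_smul_iff.mpr (M.cuspSection_le_cuspD hne hprime j n)
      _ = (M.cuspGp j).map M.PiG.subtype ⊔ M.baseSec j := Subgroup.conj_smul_eq_self_of_mem (Subgroup.mem_sup_right hs)

/-- **The node clause's left-hand side FAILS for the cusp member**: `δ S_{j,n} δ⁻¹` lies in no `Π_𝔾`-conjugate of
`I_e = Π_e·T`. [cite: MochizukiAbsTopII2013, Prop 1.3 (x) p.12] -/
theorem not_le_conj_IvNode_logPoints_cusp (hne : Sigma.Nonempty) (hprime : ∀ p ∈ Sigma, p.Prime) (j : Fin 4) {n : ℕ} (hn : 0 < n) (δ : M.P) (e : (M.dpsc hne hprime).Node) :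
    ¬ ∃ γ : (M.dpsc hne hprime).PiH, γ ∈ (M.dpsc hne hprime).PiG ∧
      (M.logPoints hne hprime (LogPt.cusp j n hn δ)).image ≤ MulAut.conj γ • (M.dpsc hne hprime).IvNode e := by
  rintro ⟨γ, hγ, hle⟩
  rw [dpsc_PiG] at hγ
  rw [logPoints_cusp_image, IvNode_eq_J] at hle
  exact M.not_conj_cuspSection_le_conj_nodeD hne hprime j hn δ hγ hle

/-- **Prop 1.3 (x) at a log point of the CUSP `c_j`** (slope `n ≥ 1`): clause 1 holds NON-IDLY (the member is
non-verticial and non-edge-like, and `c_j` is the unique cusp whose decomposition group contains a `Π_𝔾`-conjugate of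
the section); clause 2 is idle (the image IS a cusp). [cite: MochizukiAbsTopII2013, Prop 1.3 (x) p.12] -/
theorem prop13x_logPoints_cusp (hne : Sigma.Nonempty) (hprime : ∀ p ∈ Sigma, p.Prime) (j : Fin 4) {n : ℕ} (hn : 0 < n) (δ : M.P) : (M.logPoints hne hprime (LogPt.cusp j n hn δ)).Prop13x :=
  ⟨fun _ _ => M.cusp_clause_logPoints_cusp hne hprime j hn δ,
    fun h => absurd (M.logPoints_cusp_kind hne hprime j n hn δ) (h ⟨j⟩)⟩

end Cusp

section Smooth


/-- The smooth member `(v, δ)` is verticial: its section IS `δ I_v δ⁻¹`. [cite: MochizukiAbsTopII2013, Prop 1.3 (x) p.12] -/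
theorem not_isNonVerticial_logPoints_smooth (hne : Sigma.Nonempty) (hprime : ∀ p ∈ Sigma, p.Prime) (v : Fin 2) (δ : M.P) : ¬ (M.logPoints hne hprime (LogPt.smooth v δ)).IsNonVerticial := fun h =>
  h ⟨v⟩ δ (by rw [logPoints_smooth_image, ← M.vertSec_eq_Iv hne hprime v]; exact le_rfl)

/-- **The smooth member's section is a `Π_𝔾`-conjugate of `I_v`** (`δ = γ s`, `s ∈ I_v`).
[cite: MochizukiAbsTopII2013, Prop 1.3 (x) p.12] -/
theorem exists_image_eq_conj_Iv_logPoints_smooth (hne : Sigma.Nonempty) (hprime : ∀ p ∈ Sigma, p.Prime) (v : Fin 2) (δ : M.P) :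
    ∃ γ : (M.dpsc hne hprime).PiH, γ ∈ (M.dpsc hne hprime).PiG ∧
      (M.logPoints hne hprime (LogPt.smooth v δ)).image = MulAut.conj γ • (M.dpsc hne hprime).Iv ⟨v⟩ := by
  obtain ⟨γ, hγ, s, hs, rfl⟩ := M.exists_eq_mul_of_sup_eq_top (M.vertSec_sup_PiG v) δ
  refine ⟨γ, by rw [dpsc_PiG]; exact hγ, ?_⟩
  rw [logPoints_smooth_image, ← M.vertSec_eq_Iv hne hprime v]
  show MulAut.conj (γ * s) • M.vertSec v = MulAut.conj γ • M.vertSec v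
  rw [map_mul, mul_smul, Subgroup.conj_smul_eq_self_of_mem hs]

/-- **`I_{v_A}` and `I_{v_B}` are not conjugate in `P`** (`T ∩ gUg⁻¹ = 1`, abc-iut-f-066 gen 5, and `T ≠ 1`): the
section of the smooth member of `v` is no conjugate of `I_w` for `w ≠ v`. [cite: MochizukiAbsTopII2013, Prop 1.3 (iv) p.11] -/
theorem not_conj_vertSec_eq_conj_vertSec (hne : Sigma.Nonempty) (hprime : ∀ p ∈ Sigma, p.Prime) (v : Fin 2) (δ : M.P) {w : Fin 2} (hvw : v ≠ w) (g : M.P) :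
    MulAut.conj δ • M.vertSec v ≠ MulAut.conj g • M.vertSec w := by
  intro h
  -- `vertSec v = (δ⁻¹ g) • vertSec w`
  have h1 : M.vertSec v = MulAut.conj (δ⁻¹ * g) • M.vertSec w := by
    rw [map_mul, mul_smul, map_inv, eq_inv_smul_iff]; exact h
  have hT := M.T_ne_bot hne hprime
  have hv : v = 0 ∨ v = 1 := by fin_cases v <;> simp
  have hw : w = 0 ∨ w = 1 := by fin_cases w <;> simp
  rcases hv with rfl | rfl <;> rcases hw with rfl | rfl
  · exact hvw rfl
  · rw [vertSec_zero, vertSec_one] at h1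
    exact hT (by rw [← (M.T_inf_conj_U (δ⁻¹ * g)).1, ← h1, inf_idem])
  · rw [vertSec_one, vertSec_zero] at h1
    have h2 : M.T = MulAut.conj (δ⁻¹ * g)⁻¹ • M.U := by
      rw [h1, ← mul_smul, ← map_mul, inv_mul_cancel, map_one, one_smul]
    exact hT (by rw [← (M.T_inf_conj_U (δ⁻¹ * g)⁻¹).1, ← h2, inf_idem])
  · exact hvw rfl

/-- **Prop 1.3 (x) at a SMOOTH point** of the component `v`: clause 1 idle (the section IS verticial); "`τ_I(I) =
I_{v_τ}` [`Π_𝔾`-conjugate] ⇔ image a smooth point of `v_τ`" holds with both sides TRUE at `v_τ = v` and both sides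
FALSE at the other vertex (`I_{v_A}`, `I_{v_B}` not conjugate); node clause with both sides FALSE.
[cite: MochizukiAbsTopII2013, Prop 1.3 (x) p.12] -/
theorem prop13x_logPoints_smooth (hne : Sigma.Nonempty) (hprime : ∀ p ∈ Sigma, p.Prime) (v : Fin 2) (δ : M.P) : (M.logPoints hne hprime (LogPt.smooth v δ)).Prop13x := by
  refine ⟨fun hnv _ => absurd hnv (M.not_isNonVerticial_logPoints_smooth hne hprime v δ),
    fun _ => ⟨fun w => ?_, fun e => ?_⟩⟩
  · obtain ⟨w⟩ := w
    rw [logPoints_smooth_kind]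
    by_cases hvw : v = w
    · subst hvw
      exact ⟨fun _ => rfl, fun _ => M.exists_image_eq_conj_Iv_logPoints_smooth hne hprime v δ⟩
    · constructor
      · rintro ⟨γ, -, hγ⟩
        rw [logPoints_smooth_image, ← M.vertSec_eq_Iv hne hprime w] at hγ
        exact absurd hγ (M.not_conj_vertSec_eq_conj_vertSec hne hprime v δ hvw γ)
      · intro h
        exact absurd (congrArg ULift.down (DPSCIndexData.PointKind.smooth.inj h)) hvw
  · constructor
    · rintro ⟨hnv, -⟩
      exact absurd hnv (M.not_isNonVerticial_logPoints_smooth hne hprime v δ)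
    · intro h
      rw [logPoints_smooth_kind] at h
      exact absurd h (by simp)

end Smooth

/-! ### The closers -/

/-- ★ **[AbsTopII] Prop 1.3 (x) — statement of record `DPSCIndexData.Prop_1_3_x''` — HOLDS at the two-vertex nodal
datum `M.dpsc` for the family `M.logPoints` of its log points, every `Σ`, NO hypothesis.**
[cite: MochizukiAbsTopII2013, Prop 1.3 (x) p.12] -/
theorem prop_1_3_x''_dpsc (hne : Sigma.Nonempty) (hprime : ∀ p ∈ Sigma, p.Prime) : (M.dpsc hne hprime).Prop_1_3_x'' (M.logPoints hne hprime) := by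
  intro l
  cases l with
  | smooth v δ => exact M.prop13x_logPoints_smooth hne hprime v δ
  | cusp j n hn δ => exact M.prop13x_logPoints_cusp hne hprime j hn δ

/-- **No member of the family is labelled by the node, and the node clause of Prop 1.3 (x) holds at every member with
BOTH sides FALSE** (`i_e = 1`: no log point over the node; the left-hand side is refuted for cusp members by the
engine and for smooth members by verticiality). [cite: MochizukiAbsTopII2013, Prop 1.3 (x) p.12] -/
theorem node_clause_both_sides_false (hne : Sigma.Nonempty) (hprime : ∀ p ∈ Sigma, p.Prime) (l : M.LogPt) (e : (M.dpsc hne hprime).Node) :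
    (M.logPoints hne hprime l).kind ≠ DPSCIndexData.PointKind.node e ∧
      ¬ ((M.logPoints hne hprime l).IsNonVerticial ∧ ∃ γ : (M.dpsc hne hprime).PiH, γ ∈ (M.dpsc hne hprime).PiG ∧
        (M.logPoints hne hprime l).image ≤ MulAut.conj γ • (M.dpsc hne hprime).IvNode e) := by
  cases l with
  | smooth v δ =>
    exact ⟨by rw [logPoints_smooth_kind]; simp, fun h => M.not_isNonVerticial_logPoints_smooth hne hprime v δ h.1⟩
  | cusp j n hn δ =>
    exact ⟨by rw [logPoints_cusp_kind]; simp, fun h => M.not_le_conj_IvNode_logPoints_cusp hne hprime j hn δ e h.2⟩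

/-- **Census form: ONE DPSC datum WITH TWO VERTICES at which the free-label predicates `Prop_1_3_x`, `Prop_1_3_x'`
FAIL and the statement of record `Prop_1_3_x''` HOLDS for an honest family of log points** — every vertex has smooth
members, every cusp has members that are NON-VERTICIAL and NON-EDGE-LIKE (so clause 1 fires, with uniqueness among
four cusps), and no member is labelled by the node; every nonempty set of primes `Σ`, NO hypothesis.
[cite: MochizukiAbsTopII2013, Prop 1.3 (x) p.12] -/
theorem exists_twoVertex_nodal_model_x'' (Sigma : Set ℕ) (hne : Sigma.Nonempty) (hprime : ∀ p ∈ Sigma, p.Prime) :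
    ∃ (X : DPSCIndexData.{0}) (L : Type) (pt : L → X.LogPointData),
      X.Sigma = Sigma ∧ (∃ v v' : X.Vert, v ≠ v' ∧ X.Adjacent v v') ∧
      ¬ X.Prop_1_3_x ∧ ¬ X.Prop_1_3_x' ∧ X.Prop_1_3_x'' pt ∧
      (∀ v : X.Vert, ∃ l, (pt l).kind = DPSCIndexData.PointKind.smooth v) ∧
      (∀ c : X.Cusp, ∃ l, (pt l).kind = DPSCIndexData.PointKind.cusp c ∧ (pt l).IsNonVerticial ∧ (pt l).IsNonEdgeLike) ∧
      (∀ (e : X.Node) l, (pt l).kind ≠ DPSCIndexData.PointKind.node e) := by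
  obtain ⟨M⟩ := Model.nonempty Sigma
  refine ⟨M.dpsc hne hprime, M.LogPt, M.logPoints hne hprime, rfl,
    ⟨⟨(0 : Fin 2)⟩, ⟨(1 : Fin 2)⟩, M.vert_zero_ne_one hne hprime, M.adjacent_dpsc hne hprime _ _⟩,
    M.not_prop_1_3_x_dpsc hne hprime, M.not_prop_1_3_x'_dpsc hne hprime, M.prop_1_3_x''_dpsc hne hprime,
    fun v => ?_, fun c' => ?_, fun e l => (M.node_clause_both_sides_false hne hprime l e).1⟩
  · exact ⟨LogPt.smooth v.down 1, rfl⟩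
  · exact ⟨LogPt.cusp c'.down 1 Nat.one_pos 1, rfl, M.isNonVerticial_logPoints_cusp hne hprime _ Nat.one_pos _,
      M.isNonEdgeLike_logPoints_cusp hne hprime _ Nat.one_pos _⟩

end Literature.AnabelianGeometry.AbsoluteAnabelian.AbsTopII.TwoTripodNodal.Model

end
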